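import Literature.NumberTheory.PAdicHodge.AinfRamifiedFormalGroupPoints
import Mathlib.RingTheory.Polynomial.GaussLemma
import Mathlib.FieldTheory.PrimitiveElement
import HarnessLib

/-!
# The conjugate specialisations `θ_ρ : A_inf(𝒪) → 𝒪_{ℂ_F}`, `ϖ ↦ ρ`, at the other roots `ρ` of the Eisenstein
# polynomial

Topic `Literature/NumberTheory/PAdicHodge`; sequel of `AinfRamified` (`A_inf(𝒪) = 𝔸_inf(F)[X]/(f)`, `θ_𝒪`),
`AinfRamifiedTopology` (`AinfRamTop`, `θ_𝒪 : A_inf(𝒪) → 𝒪_{ℂ_F}` on the closed unit ball `CBall F`) and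
`AinfRamifiedFormalGroupPoints` (§6: the discrete coefficient ring `𝒪_D`). Let `D = (f, ϖ)` be an Eisenstein root
datum of `F` over `ℚ_p` (`f ∈ ℤ_p[X]` Eisenstein, `f(ϖ) = 0`, `ϖ ∈ F`).

Fontaine's map `θ_𝒪 : A_inf(𝒪) = 𝔸_inf ⊗_{ℤ_p} 𝒪 → 𝒪_{ℂ_F}` is `θ ⊗ (ϖ ↦ ϖ)`. Since `A_inf(𝒪) = 𝔸_inf[X]/(f)`, EVERY
root `ρ ∈ 𝒪_{ℂ_F}` of `f` gives a ring homomorphism **`θ_ρ = θ ⊗ (ϖ ↦ ρ) : A_inf(𝒪) → 𝒪_{ℂ_F}`** — for `ρ = e(ϖ)`,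
`e : F → F̄` a `ℚ_p`-embedding, this is `θ` followed... rather preceded by the conjugation `1 ⊗ e` of the
coefficients. These CONJUGATE SPECIALISATIONS are the device by which Serre (*Abelian ℓ-adic representations*
III §A.5) and Colmez (1993, §I.2) read off the Hodge–Tate weights of a Lubin–Tate character at ALL embeddings
`e : F → ℚ̄_p`: the weight at `e ≠ id` is detected by `θ_{e(ϖ)}`, under which the Lubin–Tate torsion tower does
NOT go to zero. Contents:

* §1 **`F = ℚ_p(ϖ)` when `[F : ℚ_p] = e`** (`f` is irreducible over `ℚ_p` by Eisenstein/Gauss, so it is the minimal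
  polynomial of `ϖ`; primitive element theorem in Mathlib's form `F⟮ϖ⟯ = ⊤ ↔ deg minpoly = finrank`): two
  `ℚ_p`-algebra maps out of `F` agreeing on `ϖ` are equal (`algHom_ext_root`), so **an embedding `e ≠ id` moves `ϖ`**
  (`embedding_root_ne`).
* §2 **roots of `f` in `ℂ_F`**: any root `ρ` has `‖ρ‖ < 1`, `‖ρ‖^e = ‖p‖`, hence `‖ρ‖ = ‖ϖ‖` (`norm_eq_norm_root_of_isRoot`);
  `e(ϖ)` is a root (`isRoot_embedding`).
* §3 **`θ_ρ` on `A_inf(𝒪)`** (`AinfRam.thetaConj`): `θ` on `𝔸_inf`, `ϖ ↦ ρ`; on the coefficient ring `𝒪_D` it is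
  `e` (`coe_thetaConj_coeffHom_embedding`); **`θ_ρ ≡ θ_𝒪 mod (ρ − ϖ)`** (`thetaConj_sub_theta_mem`: both agree on
  `𝔸_inf`); **`θ_ρ ∘ σ = σ ∘ θ_ρ` for `σ ∈ Γ_F` fixing `ρ`** (`coe_thetaConj_gal`).
* §4 the same on the topological ring `AinfRamTop D` with values in `CBall F` (`AinfRamTop.thetaConj`), with the norm
  form of the congruence `‖θ_ρ(x) − θ_𝒪(x)‖ ≤ ‖ρ − ϖ‖` (`norm_thetaConj_sub_theta_le`).

No named facts, no `sorry`. Used by `LubinTateCharacterConjugatesTotallyRamified` (hypothesis (H) of the Lubin–Tate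
character files for totally ramified `F`).

## References
* [SerreAbelianLadic1968] J.-P. Serre, *Abelian ℓ-adic representations and elliptic curves* (1968), Ch. III App. A.5.
* [Colmez1993] P. Colmez, *Périodes des variétés abéliennes à multiplication complexe*, Ann. of Math. 138 (1993), §I.2.
* [FarguesFontaine2018] L. Fargues, J.-M. Fontaine, Astérisque 406 (2018), §1.2, §2.2.
* [FontaineAsterisque223III] J.-M. Fontaine, *Le corps des périodes p-adiques*, Astérisque 223 (1994), Exp. II §1.2.
* [SerreLocalFields1979] J.-P. Serre, *Local Fields*, GTM 67, Ch. I §6 (Eisenstein polynomials, Prop. 17–18).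
-/

noncomputable section

open ValuativeRel Field Ideal WittVector Polynomial

namespace Literature.NumberTheory.PAdicHodge

open Literature.NumberTheory.GaloisRepresentations
open Literature.NumberTheory.GaloisRepresentations.IsNonarchimedeanLocalField
open Literature.NumberTheory.GaloisRepresentations.LubinTate

variable {F : Type} [Field F] [ValuativeRel F] [TopologicalSpace F] [IsNonarchimedeanLocalField F] [CharZero F]
  {p : ℕ} [Fact p.Prime] {hp : valuation F p < 1}

namespace EisensteinRoot

variable (D : EisensteinRoot F p hp)

/-! ## §1 `F = ℚ_p(ϖ)`: algebra maps out of `F` are determined by the image of `ϖ` -/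

/-- **An Eisenstein polynomial is irreducible over `ℤ_p`** (Mathlib's Eisenstein criterion; a private copy of
`AinfRamifiedEtaPeriod`'s `irreducible_poly`, to keep the imports light). [cite: SerreLocalFields1979, Ch. I §6 Prop. 17] -/
private theorem irreducible_poly' : Irreducible D.poly :=
  D.isEisensteinAt.irreducible ((Ideal.span_singleton_prime PadicInt.prime_p.ne_zero).2 PadicInt.prime_p)
    D.monic.isPrimitive D.e_pos

/-- … hence irreducible over `ℚ_p` (Gauss's lemma), read in the copy `PadicBase F p hp` of `ℚ_p`.
[cite: SerreLocalFields1979, Ch. I §6 Prop. 17] -/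
theorem irreducible_poly_map_base : Irreducible (D.poly.map (PadicBase.ofPadicInt hp)) := by
  have h1 : Irreducible (D.poly.map (algebraMap ℤ_[p] ℚ_[p])) :=
    (D.monic.irreducible_iff_irreducible_map_fraction_map).1 D.irreducible_poly'
  have h2 : D.poly.map (PadicBase.ofPadicInt hp) =
      Polynomial.mapEquiv (PadicBase.toPadic hp).symm (D.poly.map (algebraMap ℤ_[p] ℚ_[p])) := by
    rw [Polynomial.mapEquiv_apply, Polynomial.map_map]
    rfl
  rw [h2]
  exact (MulEquiv.irreducible_iff (Polynomial.mapEquiv (PadicBase.toPadic hp).symm)).2 h1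

/-- `f(ϖ) = 0` with `f` read over `ℚ_p ⊆ F`. [cite: SerreLocalFields1979, Ch. I §6 Prop. 17] -/
theorem aeval_root_poly_map_base : Polynomial.aeval D.root (D.poly.map (PadicBase.ofPadicInt hp)) = 0 := by
  rw [Polynomial.aeval_def, Polynomial.eval₂_map]; exact D.eval₂_root

/-- **`f` is the minimal polynomial of `ϖ` over `ℚ_p`.** [cite: SerreLocalFields1979, Ch. I §6 Prop. 17] -/
theorem minpoly_root : minpoly (PadicBase F p hp) D.root = D.poly.map (PadicBase.ofPadicInt hp) :=
  (minpoly.eq_of_irreducible_of_monic D.irreducible_poly_map_base D.aeval_root_poly_map_base (D.monic.map _)).symm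

/-- `deg_{ℚ_p} ϖ = e`. [cite: SerreLocalFields1979, Ch. I §6 Prop. 17] -/
theorem natDegree_minpoly_root : (minpoly (PadicBase F p hp) D.root).natDegree = D.e := by
  rw [minpoly_root, D.monic.natDegree_map, e_def]

/-- **`F = ℚ_p(ϖ)` when `[F : ℚ_p] = e`** (i.e. `F/ℚ_p` totally ramified with uniformizer `ϖ`; primitive element in
Mathlib's form). [cite: SerreLocalFields1979, Ch. I §6 Prop. 18] -/
theorem adjoin_root_eq_top (hd : Module.finrank (PadicBase F p hp) F = D.e) :
    IntermediateField.adjoin (PadicBase F p hp) {D.root} = ⊤ :=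
  (Field.primitive_element_iff_minpoly_natDegree_eq (PadicBase F p hp) D.root).2 (by rw [natDegree_minpoly_root, hd])

/-- `F = ℚ_p[ϖ]` as a `ℚ_p`-algebra. [cite: SerreLocalFields1979, Ch. I §6 Prop. 18] -/
theorem algebra_adjoin_root_eq_top (hd : Module.finrank (PadicBase F p hp) F = D.e) :
    Algebra.adjoin (PadicBase F p hp) {D.root} = ⊤ :=
  Algebra.adjoin_eq_top_of_primitive_element (Algebra.IsAlgebraic.isAlgebraic D.root) (D.adjoin_root_eq_top hd)

/-- **Two `ℚ_p`-algebra maps out of `F` that agree on `ϖ` are equal** (`[F : ℚ_p] = e`). [cite: SerreLocalFields1979, Ch. I §6 Prop. 18] -/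
theorem algHom_ext_root (hd : Module.finrank (PadicBase F p hp) F = D.e) {B : Type*} [Semiring B]
    [Algebra (PadicBase F p hp) B] {φ ψ : F →ₐ[PadicBase F p hp] B} (h : φ D.root = ψ D.root) : φ = ψ :=
  AlgHom.ext_of_adjoin_eq_top (D.algebra_adjoin_root_eq_top hd) fun x hx => by
    rw [Set.mem_singleton_iff.1 hx]; exact h

/-- **An embedding `e : F → F̄` over `ℚ_p` other than the inclusion moves `ϖ`** (`[F : ℚ_p] = e`).
[cite: SerreAbelianLadic1968, Ch. III §A.5] -/
theorem embedding_root_ne (hd : Module.finrank (PadicBase F p hp) F = D.e)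
    (e : F →ₐ[PadicBase F p hp] NormedAlgClosure F)
    (he : e ≠ IsScalarTower.toAlgHom (PadicBase F p hp) F (NormedAlgClosure F)) :
    e D.root ≠ algebraMap F (NormedAlgClosure F) D.root := fun h =>
  he (D.algHom_ext_root hd (by rw [h, IsScalarTower.toAlgHom_apply]))

/-! ## §2 The roots of `f` in `ℂ_F` -/

section Roots

variable {ρ : CompletedAlgClosure F}
  (hρ : D.poly.eval₂ ((algebraMap F (CompletedAlgClosure F)).comp (zpToF hp)) ρ = 0)

include hρ in
/-- `ρ^e = -(c₀ + c₁ρ + ⋯ + c_{e-1}ρ^{e-1})` for a root `ρ ∈ ℂ_F` of `f`. [cite: SerreLocalFields1979, Ch. I §6 Prop. 17] -/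
theorem pow_e_eq_of_isRoot :
    ρ ^ D.e = - ∑ i ∈ Finset.range D.e, algebraMap F (CompletedAlgClosure F) (zpToF hp (D.poly.coeff i)) * ρ ^ i := by
  have h := hρ
  rw [Polynomial.eval₂_eq_sum_range, Finset.sum_range_succ] at h
  have hlead : D.poly.coeff D.poly.natDegree = 1 := D.monic
  rw [hlead, map_one, one_mul] at h
  rw [e_def, eq_neg_iff_add_eq_zero, add_comm]
  exact h

include hρ in
/-- **`‖ρ‖ < 1`** for every root `ρ ∈ ℂ_F` of the Eisenstein polynomial. [cite: SerreLocalFields1979, Ch. I §6 Prop. 17] -/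
theorem norm_lt_one_of_isRoot : ‖ρ‖ < 1 := by
  by_contra hge
  rw [not_lt] at hge
  have hp1 : ‖(p : CompletedAlgClosure F)‖ < 1 := norm_natCast_C_lt_one hp
  have he := D.e_pos
  have hbound : ‖ρ ^ D.e‖ ≤ ‖(p : CompletedAlgClosure F)‖ * ‖ρ‖ ^ (D.e - 1) := by
    rw [D.pow_e_eq_of_isRoot hρ, norm_neg]
    refine IsUltrametricDist.norm_sum_le_of_forall_le_of_nonneg (by positivity) fun i hi => ?_
    rw [Finset.mem_range] at hi
    rw [norm_mul, norm_pow]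
    refine mul_le_mul (norm_algebraMap_zpToF_le_of_dvd hp (D.dvd_coeff hi)) ?_ (by positivity) (norm_nonneg _)
    exact pow_le_pow_right₀ hge (by omega)
  have hlt : ‖(p : CompletedAlgClosure F)‖ * ‖ρ‖ ^ (D.e - 1) < ‖ρ‖ ^ D.e := by
    calc ‖(p : CompletedAlgClosure F)‖ * ‖ρ‖ ^ (D.e - 1) < 1 * ‖ρ‖ ^ (D.e - 1) := by gcongr
      _ ≤ ‖ρ‖ ^ D.e := by
        rw [one_mul]
        exact pow_le_pow_right₀ hge (Nat.sub_le _ _)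
  rw [norm_pow] at hbound
  exact absurd (hbound.trans_lt hlt) (lt_irrefl _)

include hρ in
/-- **`‖ρ‖^e = ‖p‖`** for every root `ρ ∈ ℂ_F` of `f` (the constant term `c₀ = p·unit` dominates).
[cite: SerreLocalFields1979, Ch. I §6 Prop. 17] -/
theorem norm_pow_e_of_isRoot : ‖ρ‖ ^ D.e = ‖(p : CompletedAlgClosure F)‖ := by
  have hx1 : ‖ρ‖ < 1 := D.norm_lt_one_of_isRoot hρ
  obtain ⟨u, hu⟩ := D.exists_coeff_zero_eq_mul_unit
  have hc0 : ‖algebraMap F (CompletedAlgClosure F) (zpToF hp (D.poly.coeff 0))‖ = ‖(p : CompletedAlgClosure F)‖ := by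
    rw [hu, map_mul, map_mul, map_natCast, map_natCast, norm_mul, norm_algebraMap_zpToF_unit, mul_one]
  have hp0 : 0 < ‖(p : CompletedAlgClosure F)‖ := norm_pos_iff.2 (natCast_C_ne_zero (Fact.out : p.Prime).ne_zero)
  have hsplit : ρ ^ D.e = -(algebraMap F (CompletedAlgClosure F) (zpToF hp (D.poly.coeff 0)) +
      ∑ i ∈ Finset.Ico 1 D.e, algebraMap F (CompletedAlgClosure F) (zpToF hp (D.poly.coeff i)) * ρ ^ i) := by
    rw [D.pow_e_eq_of_isRoot hρ, Finset.range_eq_Ico, Finset.sum_eq_sum_Ico_succ_bot D.e_pos, pow_zero, mul_one]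
  have htail : ‖∑ i ∈ Finset.Ico 1 D.e, algebraMap F (CompletedAlgClosure F) (zpToF hp (D.poly.coeff i)) * ρ ^ i‖ <
      ‖(p : CompletedAlgClosure F)‖ := by
    refine lt_of_le_of_lt (IsUltrametricDist.norm_sum_le_of_forall_le_of_nonneg (C := ‖(p : CompletedAlgClosure F)‖ * ‖ρ‖)
      (by positivity) fun i hi => ?_) ?_
    · rw [Finset.mem_Ico] at hi
      rw [norm_mul, norm_pow]
      refine mul_le_mul (norm_algebraMap_zpToF_le_of_dvd hp (D.dvd_coeff hi.2)) ?_ (by positivity) (norm_nonneg _)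
      calc ‖ρ‖ ^ i ≤ ‖ρ‖ ^ 1 := pow_le_pow_of_le_one (norm_nonneg _) hx1.le hi.1
        _ = ‖ρ‖ := pow_one _
    · calc ‖(p : CompletedAlgClosure F)‖ * ‖ρ‖ < ‖(p : CompletedAlgClosure F)‖ * 1 := by gcongr
        _ = _ := mul_one _
  rw [← norm_pow, hsplit, norm_neg]
  rw [← hc0] at htail ⊢
  exact IsUltrametricDist.norm_add_eq_max_of_norm_ne_norm (ne_of_gt htail) |>.trans (max_eq_left htail.le)

include hρ in
/-- **All roots of `f` in `ℂ_F` have the same absolute value `‖ρ‖ = ‖ϖ‖ = ‖p‖^{1/e}`.** [cite: SerreLocalFields1979, Ch. I §6 Prop. 17] -/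
theorem norm_eq_norm_root_of_isRoot : ‖ρ‖ = ‖algebraMap F (CompletedAlgClosure F) D.root‖ :=
  (pow_left_inj₀ (norm_nonneg _) (norm_nonneg _) D.e_pos.ne').1
    ((D.norm_pow_e_of_isRoot hρ).trans D.norm_algebraMap_root_pow.symm)

/-- **A root `ρ ∈ 𝒪_{ℂ_F}`** of `f` (tree `integerC F`). [cite: SerreLocalFields1979, Ch. I §6 Prop. 17] -/
def rootOfC : integerC F := ⟨ρ, (mem_integerC_iff).2 (D.norm_lt_one_of_isRoot hρ).le⟩

/-- Unfolding `rootOfC`. [cite: SerreLocalFields1979, Ch. I §6 Prop. 17] -/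
@[simp] theorem coe_rootOfC : ((D.rootOfC hρ : integerC F) : CompletedAlgClosure F) = ρ := rfl

/-- `f(ρ) = 0` read in `𝒪_{ℂ_F}` along `ℤ_p → 𝒪_{ℂ_F}`. [cite: SerreLocalFields1979, Ch. I §6 Prop. 17] -/
theorem eval₂_toIntC_rootOfC : D.poly.eval₂ (toIntC hp) (D.rootOfC hρ) = 0 := by
  apply Subtype.ext
  change ((D.poly.eval₂ (toIntC hp) (D.rootOfC hρ) : integerC F) : CompletedAlgClosure F) = 0
  rw [show ((D.poly.eval₂ (toIntC hp) (D.rootOfC hρ) : integerC F) : CompletedAlgClosure F) =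
      D.poly.eval₂ ((integerC F).subtype.comp (toIntC hp)) (D.rootOfC hρ : CompletedAlgClosure F) from
    Polynomial.hom_eval₂ _ _ (integerC F).subtype _]
  rw [coe_rootOfC]
  convert hρ using 2
  refine RingHom.ext fun z => ?_
  rw [RingHom.comp_apply, RingHom.comp_apply, Subring.subtype_apply, algebraMap_zpToF]

end Roots

/-- **`e(ϖ)` is a root of `f` in `ℂ_F`** for every `ℚ_p`-embedding `e : F → F̄`. [cite: SerreAbelianLadic1968, Ch. III §A.5] -/
theorem isRoot_embedding (e : F →ₐ[PadicBase F p hp] NormedAlgClosure F) :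
    D.poly.eval₂ ((algebraMap F (CompletedAlgClosure F)).comp (zpToF hp))
      ((e D.root : NormedAlgClosure F) : CompletedAlgClosure F) = 0 := by
  set c : NormedAlgClosure F →+* CompletedAlgClosure F := UniformSpace.Completion.coeRingHom with hc
  have hφ : (algebraMap F (CompletedAlgClosure F)).comp (zpToF hp) =
      (c.comp (e : F →+* NormedAlgClosure F)).comp (zpToF hp) := by
    refine RingHom.ext fun z => ?_
    simp only [RingHom.comp_apply, RingHom.coe_coe]
    rw [zpToF_apply, AlgHom.commutes, PadicBase.algebraMap_closure_eq, CompletedAlgClosure.algebraMap_eq_coe]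
    rfl
  rw [hφ, show ((e D.root : NormedAlgClosure F) : CompletedAlgClosure F) = (c.comp (e : F →+* NormedAlgClosure F)) D.root
    from rfl, ← Polynomial.hom_eval₂, D.eval₂_root, map_zero]

end EisensteinRoot

/-! ## §3 `θ_ρ : A_inf(𝒪) → 𝒪_{ℂ_F}`, `ϖ ↦ ρ` -/

namespace AinfRam

variable [Fact (¬ IsUnit (p : integerC F))] [IsAdicComplete (Ideal.span {(p : integerC F)}) (integerC F)]
  (D : EisensteinRoot F p hp) {ρ : CompletedAlgClosure F}
  (hρ : D.poly.eval₂ ((algebraMap F (CompletedAlgClosure F)).comp (zpToF hp)) ρ = 0)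

/-- **The conjugate specialisation `θ_ρ = θ ⊗ (ϖ ↦ ρ) : A_inf(𝒪) = 𝔸_inf(F)[X]/(f) → 𝒪_{ℂ_F}`** at a root `ρ ∈ 𝒪_{ℂ_F}`
of `f` (for `ρ = ϖ` this is `θ_𝒪 = AinfRam.theta`). [cite: SerreAbelianLadic1968, Ch. III §A.5] [cite: FarguesFontaine2018, §2.2] -/
def thetaConj : AinfRam D →+* integerC F :=
  AdjoinRoot.lift (fontaineTheta (integerC F) p) (D.rootOfC hρ) (by
    rw [EisensteinRoot.eval₂_polyAinf, fontaineTheta_comp_zpToAinf]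
    exact D.eval₂_toIntC_rootOfC hρ)

/-- `θ_ρ` extends `θ`. [cite: FontaineAsterisque223III, Exp. II §1.2.2] -/
@[simp] theorem thetaConj_algebraMap (a : Ainf (p := p) F) :
    thetaConj D hρ (algebraMap (Ainf (p := p) F) (AinfRam D) a) = fontaineTheta (integerC F) p a := AdjoinRoot.lift_of _

/-- **`θ_ρ(ϖ) = ρ`.** [cite: SerreAbelianLadic1968, Ch. III §A.5] -/
@[simp] theorem thetaConj_varpi : thetaConj D hρ (varpi D) = D.rootOfC hρ := AdjoinRoot.lift_root _

/-- `θ_ρ(ϖ) = ρ` in `ℂ_F`. [cite: SerreAbelianLadic1968, Ch. III §A.5] -/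
theorem coe_thetaConj_varpi : ((thetaConj D hρ (varpi D) : integerC F) : CompletedAlgClosure F) = ρ := by
  rw [thetaConj_varpi]; rfl

/-- **`θ_ρ` on the coefficient ring `𝒪_D = ℤ_p[X]/(f)`** is the unique `g : 𝒪_D → ℂ_F` with `g|_{ℤ_p} = ι` and `g(X) = ρ`.
[cite: SerreAbelianLadic1968, Ch. III §A.5] -/
theorem coe_thetaConj_coeffHom {g : D.Coeff →+* CompletedAlgClosure F}
    (hg_of : ∀ z : ℤ_[p], g (AdjoinRoot.of D.poly z) = algebraMap F (CompletedAlgClosure F) (zpToF hp z))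
    (hg_root : g (AdjoinRoot.root D.poly) = ρ) (x : D.Coeff) :
    ((thetaConj D hρ (coeffHom D x) : integerC F) : CompletedAlgClosure F) = g x := by
  have h : ((integerC F).subtype.comp ((thetaConj D hρ).comp (coeffHom D))) = g := by
    refine Ideal.Quotient.ringHom_ext (Polynomial.ringHom_ext' (RingHom.ext fun z => ?_) ?_)
    · change ((thetaConj D hρ (coeffHom D (AdjoinRoot.of D.poly z)) : integerC F) : CompletedAlgClosure F) =
        g (AdjoinRoot.of D.poly z)
      rw [coeffHom_of, thetaConj_algebraMap, fontaineTheta_zpToAinf hp, hg_of, algebraMap_zpToF]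
    · change ((thetaConj D hρ (coeffHom D (AdjoinRoot.root D.poly)) : integerC F) : CompletedAlgClosure F) =
        g (AdjoinRoot.root D.poly)
      rw [coeffHom_root, coe_thetaConj_varpi, hg_root]
  exact RingHom.congr_fun h x

/-- **For `ρ = e(ϖ)`, `θ_ρ` restricted to `𝒪_D ⊆ F` is the embedding `e`.** [cite: SerreAbelianLadic1968, Ch. III §A.5] -/
theorem coe_thetaConj_coeffHom_embedding (e : F →ₐ[PadicBase F p hp] NormedAlgClosure F) (x : D.Coeff) :
    ((thetaConj D (D.isRoot_embedding e) (coeffHom D x) : integerC F) : CompletedAlgClosure F) =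
      ((e (EisensteinRoot.Coeff.toF D x) : NormedAlgClosure F) : CompletedAlgClosure F) := by
  refine coe_thetaConj_coeffHom D (D.isRoot_embedding e)
    (g := (UniformSpace.Completion.coeRingHom : NormedAlgClosure F →+* CompletedAlgClosure F).comp
      ((e : F →+* NormedAlgClosure F).comp (EisensteinRoot.Coeff.toF D))) (fun z => ?_) ?_ x
  · simp only [RingHom.comp_apply, RingHom.coe_coe, EisensteinRoot.Coeff.toF_of]
    rw [zpToF_apply, AlgHom.commutes, PadicBase.algebraMap_closure_eq, CompletedAlgClosure.algebraMap_eq_coe]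
    rfl
  · simp only [RingHom.comp_apply, RingHom.coe_coe, EisensteinRoot.Coeff.toF_root]
    rfl

/-- **`θ_ρ ≡ θ_𝒪 (mod (ρ − ϖ)𝒪_{ℂ_F})`**: both are `θ` on `𝔸_inf` and differ by `ρ − ϖ` on `ϖ`.
[cite: SerreAbelianLadic1968, Ch. III §A.5] [cite: FarguesFontaine2018, §2.2] -/
theorem thetaConj_sub_theta_mem (x : AinfRam D) :
    thetaConj D hρ x - theta D x ∈ Ideal.span {D.rootOfC hρ - D.rootC} := by
  rw [← Ideal.Quotient.eq]
  have h : (Ideal.Quotient.mk (Ideal.span {D.rootOfC hρ - D.rootC})).comp (thetaConj D hρ) =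
      (Ideal.Quotient.mk (Ideal.span {D.rootOfC hρ - D.rootC})).comp (theta D) :=
    ringHom_ext D (fun a => by rw [RingHom.comp_apply, RingHom.comp_apply, thetaConj_algebraMap, theta_algebraMap])
      (by rw [RingHom.comp_apply, RingHom.comp_apply, thetaConj_varpi, theta_varpi, Ideal.Quotient.eq]
          exact Ideal.mem_span_singleton_self _)
  exact RingHom.congr_fun h x

/-- **`θ_ρ ∘ σ = σ ∘ θ_ρ` for `σ ∈ Γ_F` with `σ(ρ) = ρ`** (`θ` is `Γ_F`-equivariant and `σ` fixes `ϖ ∈ A_inf(𝒪)`).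
[cite: FontaineAsterisque223III, Exp. II §1.2] [cite: SerreAbelianLadic1968, Ch. III §A.5] -/
theorem coe_thetaConj_gal (σ : absoluteGaloisGroup F) (hσ : σ • ρ = ρ) (x : AinfRam D) :
    ((thetaConj D hρ (gal D σ x) : integerC F) : CompletedAlgClosure F) =
      σ • ((thetaConj D hρ x : integerC F) : CompletedAlgClosure F) := by
  have h : (integerC F).subtype.comp ((thetaConj D hρ).comp (gal D σ)) =
      (CompletedAlgClosure.galRingHom σ).comp ((integerC F).subtype.comp (thetaConj D hρ)) := by
    refine ringHom_ext D (fun a => ?_) ?_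
    · change ((thetaConj D hρ (gal D σ (algebraMap _ _ a)) : integerC F) : CompletedAlgClosure F) =
        CompletedAlgClosure.galRingHom σ ((thetaConj D hρ (algebraMap _ _ a) : integerC F) : CompletedAlgClosure F)
      rw [gal_algebraMap, thetaConj_algebraMap, thetaConj_algebraMap, fontaineTheta_galAinf, coe_galInt]; rfl
    · change ((thetaConj D hρ (gal D σ (varpi D)) : integerC F) : CompletedAlgClosure F) =
        CompletedAlgClosure.galRingHom σ ((thetaConj D hρ (varpi D) : integerC F) : CompletedAlgClosure F)
      rw [gal_varpi, coe_thetaConj_varpi, ← CompletedAlgClosure.smul_def, hσ]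
  exact RingHom.congr_fun h x

end AinfRam

/-! ## §4 `θ_ρ` on the topological ring `AinfRamTop D`, with values in `CBall F` -/

namespace AinfRamTop

variable [Fact (¬ IsUnit (p : integerC F))] [IsAdicComplete (Ideal.span {(p : integerC F)}) (integerC F)]
  (D : EisensteinRoot F p hp) {ρ : CompletedAlgClosure F}
  (hρ : D.poly.eval₂ ((algebraMap F (CompletedAlgClosure F)).comp (zpToF hp)) ρ = 0)

/-- **`θ_ρ : A_inf(𝒪) → 𝒪_{ℂ_F}`** on `AinfRamTop D`, valued in the closed unit ball `CBall F`.
[cite: SerreAbelianLadic1968, Ch. III §A.5] [cite: FarguesFontaine2018, §2.2] -/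
def thetaConj : AinfRamTop D →+* CBall F :=
  (integerCEquivCBall (F := F)).toRingHom.comp ((AinfRam.thetaConj D hρ).comp (of D).symm.toRingHom)

/-- Unfolding `thetaConj` in `ℂ_F`. [cite: SerreAbelianLadic1968, Ch. III §A.5] -/
theorem coe_thetaConj (a : AinfRam D) :
    ((thetaConj D hρ (of D a) : CBall F) : CompletedAlgClosure F) = (AinfRam.thetaConj D hρ a : integerC F) := rfl

/-- Unfolding `thetaConj` on an element of the synonym. [cite: SerreAbelianLadic1968, Ch. III §A.5] -/
theorem coe_thetaConj' (a : AinfRamTop D) :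
    ((thetaConj D hρ a : CBall F) : CompletedAlgClosure F) = (AinfRam.thetaConj D hρ ((of D).symm a) : integerC F) := rfl

/-- **`θ_{e(ϖ)}` on the coefficients `𝒪_D` is `e`**: `θ_{e(ϖ)}(a·1) = e(a)`. [cite: SerreAbelianLadic1968, Ch. III §A.5] -/
theorem coe_thetaConj_algebraMap_coeffDisc (e : F →ₐ[PadicBase F p hp] NormedAlgClosure F) (x : D.Coeff) :
    ((thetaConj D (D.isRoot_embedding e)
        (algebraMap (EisensteinRoot.CoeffDisc D) (AinfRamTop D) (EisensteinRoot.CoeffDisc.of D x)) : CBall F) :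
        CompletedAlgClosure F) =
      ((e (EisensteinRoot.Coeff.toF D x) : NormedAlgClosure F) : CompletedAlgClosure F) := by
  rw [EisensteinRoot.algebraMap_coeffDisc_ainfRamTop, coe_thetaConj]
  exact AinfRam.coe_thetaConj_coeffHom_embedding D e x

/-- In particular **`θ_{e(ϖ)}(ϖ_D · 1) = e(ϖ)`**. [cite: SerreAbelianLadic1968, Ch. III §A.5] -/
theorem coe_thetaConj_algebraMap_varpiDisc (e : F →ₐ[PadicBase F p hp] NormedAlgClosure F) :
    ((thetaConj D (D.isRoot_embedding e)
        (algebraMap (EisensteinRoot.CoeffDisc D) (AinfRamTop D) (EisensteinRoot.CoeffDisc.of D (AdjoinRoot.root D.poly))) :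
        CBall F) : CompletedAlgClosure F) =
      ((e D.root : NormedAlgClosure F) : CompletedAlgClosure F) := by
  rw [coe_thetaConj_algebraMap_coeffDisc, EisensteinRoot.Coeff.toF_root]

/-- **`‖θ_ρ(x) − θ_𝒪(x)‖ ≤ ‖ρ − ϖ‖`** for every `x ∈ A_inf(𝒪)` (norm form of `θ_ρ ≡ θ_𝒪 mod (ρ − ϖ)`).
[cite: SerreAbelianLadic1968, Ch. III §A.5] -/
theorem norm_thetaConj_sub_theta_le (x : AinfRamTop D) :
    ‖((thetaConj D hρ x : CBall F) : CompletedAlgClosure F) - ((theta D x : CBall F) : CompletedAlgClosure F)‖ ≤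
      ‖ρ - algebraMap F (CompletedAlgClosure F) D.root‖ := by
  have h := AinfRam.thetaConj_sub_theta_mem D hρ ((of D).symm x)
  rw [Ideal.mem_span_singleton'] at h
  obtain ⟨b, hb⟩ := h
  have hb' : ((AinfRam.thetaConj D hρ ((of D).symm x) : integerC F) : CompletedAlgClosure F) -
      ((AinfRam.theta D ((of D).symm x) : integerC F) : CompletedAlgClosure F) =
      (b : CompletedAlgClosure F) * (ρ - algebraMap F (CompletedAlgClosure F) D.root) := by
    have h2 := congrArg (fun y : integerC F => (y : CompletedAlgClosure F)) hb
    simpa using h2.symm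
  have hb1 : ‖(b : CompletedAlgClosure F)‖ ≤ 1 := (mem_integerC_iff).1 b.2
  rw [coe_thetaConj', show ((theta D x : CBall F) : CompletedAlgClosure F) =
      ((AinfRam.theta D ((of D).symm x) : integerC F) : CompletedAlgClosure F) from rfl, hb', norm_mul]
  exact mul_le_of_le_one_left (norm_nonneg _) hb1

/-- **`θ_ρ ∘ σ = σ ∘ θ_ρ`** on `AinfRamTop` for `σ ∈ Γ_F` fixing `ρ`. [cite: FontaineAsterisque223III, Exp. II §1.2] -/
theorem coe_thetaConj_gal (σ : absoluteGaloisGroup F) (hσ : σ • ρ = ρ) (a : AinfRamTop D) :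
    ((thetaConj D hρ (gal D σ a) : CBall F) : CompletedAlgClosure F) =
      σ • ((thetaConj D hρ a : CBall F) : CompletedAlgClosure F) :=
  AinfRam.coe_thetaConj_gal D hρ σ hσ ((of D).symm a)

/-- `θ_ρ` takes values of norm `≤ 1`; on `𝔫_𝒪`-elements of norm `< 1` under `θ_𝒪` … (only the trivial bound is
needed downstream). [cite: SerreAbelianLadic1968, Ch. III §A.5] -/
theorem norm_thetaConj_le_one (a : AinfRamTop D) : ‖((thetaConj D hρ a : CBall F) : CompletedAlgClosure F)‖ ≤ 1 :=
  (LubinTate.mem_unitBall_iff _).1 (thetaConj D hρ a).2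

end AinfRamTop

end Literature.NumberTheory.PAdicHodge

end
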